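import Literature.Probability.Percolation.PortLink
import HarnessLib

/-!
# The port chain theorem in the presence of excised squares

Topic `Probability/Percolation`.  Support file (proofs, no named fact) for step (C) of the proof of
Schramm–Smirnov's Prop. 4.1 (Ann. Probab. 39 (2011), §4).  `PortChain.lean` / `PortLink.lean`
identify the crossing event of the cut quad with the port chain under the hypothesis `hX` that every
edge leaving the window is examined; with the excised junction squares `SQ` (the modification `ω̃`)
an edge from the window to a square is neither examined nor open.  The only use of `hX` is the
junction lemma (an open accessible edge followed by an open inaccessible edge meet at a hub
vertex), which survives when square edges are closed in the modified configuration
(`junction_mem_O_sq`).  The (⇒) direction of the side chain and the port chain theorem are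
re-derived with this input (`sideChain_of_mem_z2QuadConfig_sq`, `portChain_iff_mem_z2QuadConfig_sq`);
the (⇐) direction is the tree's, unchanged.

## References

* O. Schramm, S. Smirnov, *On the scaling limits of planar percolation*, Ann. Probab. 39 (2011)
  1768–1814, arXiv:1101.5820, §4, proof of Prop. 4.1 ("ω̃ ∈ ⊞_{Q₀} iff there is a path from
  `∂₀Q₀` to `∂₂Q₀` in `G ∪ G*`"). [SchrammSmirnov2011]
-/

noncomputable section

open Set Relation
open Literature.Probability.LatticeModels
open scoped Classical

namespace Literature.Probability.Percolation

namespace CellComplex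

namespace TileData

open QuadCrossing

variable {𝒯 : TileData} {d₀ : Site 2 × Fin 4}

/-! ### The junction lemma with squares -/

/-- **Junctions are hub vertices** (with squares): an open accessible edge followed by an open
inaccessible edge meet at a hub vertex — when examined closed edges and square edges are closed and
edges leaving the window are examined or touch a square. [folklore] -/
theorem junction_mem_O_sq {η : BondConfig (Site 2)} {SQ : Set (Site 2)} (hcons : ∀ e ∈ 𝒯.clE, e ∉ η)
    (hηSQ : ∀ e ∈ (zdGraph 2).edgeSet, (∃ q ∈ e, q ∈ SQ) → e ∉ η)
    (hX : ∀ e ∈ (zdGraph 2).edgeSet, (∃ v ∈ e, v ∈ 𝒯.Wv) → (∃ u ∈ e, u ∉ 𝒯.Wv) →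
      e ∈ 𝒯.hubE ∨ e ∈ 𝒯.clE ∨ ∃ q ∈ e, q ∈ SQ) :
    ∀ u v w : Site 2, (zdGraph 2).Adj u v → (zdGraph 2).Adj v w → s(u, v) ∈ η → s(v, w) ∈ η →
      s(u, v) ∈ (↑𝒯.acc : Set (Sym2 (Site 2))) → s(v, w) ∉ (↑𝒯.acc : Set (Sym2 (Site 2))) → v ∈ 𝒯.O := by
  intro u v w _ hadj huvη hvwη huv hvw
  by_contra hvO
  have huv' : s(u, v) ∈ 𝒯.acc := huv
  have hvW : v ∈ 𝒯.Wv := 𝒯.acc_window _ huv' v (Sym2.mem_mk_right u v)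
  have hvwE : s(v, w) ∈ (zdGraph 2).edgeSet := (SimpleGraph.mem_edgeSet (G := zdGraph 2)).2 hadj
  by_cases hwW : w ∈ 𝒯.Wv
  · -- a window edge at an accessible non-hub vertex is examined or accessible
    rcases 𝒯.closure _ huv' v (Sym2.mem_mk_right u v) hvO _ hvwE (Sym2.mem_mk_left v w)
      (fun z hz => by rcases Sym2.mem_iff.1 hz with rfl | rfl <;> assumption) with h | h | h
    · exact hvO (𝒯.hub_O _ h v (Sym2.mem_mk_left v w))
    · exact hcons _ h hvwη
    · exact hvw h
  · rcases hX _ hvwE ⟨v, Sym2.mem_mk_left v w, hvW⟩ ⟨w, Sym2.mem_mk_right v w, hwW⟩ with h | h | h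
    · exact hvO (𝒯.hub_O _ h v (Sym2.mem_mk_left v w))
    · exact hcons _ h hvwη
    · exact hηSQ _ hvwE h hvwη

/-! ### The side chain with squares -/

section SideChain

variable {D : Set ℂ} {δ : ℝ} {Q : Quad D} {η : BondConfig (Site 2)} {SQ : Set (Site 2)}

variable (h₀ : IsBd 𝒯.U d₀) (hδ : 0 < δ)
  (hcons : ∀ e ∈ 𝒯.clE, e ∉ η)
  (hηSQ : ∀ e ∈ (zdGraph 2).edgeSet, (∃ q ∈ e, q ∈ SQ) → e ∉ η)
  (hX : ∀ e ∈ (zdGraph 2).edgeSet, (∃ v ∈ e, v ∈ 𝒯.Wv) → (∃ u ∈ e, u ∉ 𝒯.Wv) →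
    e ∈ 𝒯.hubE ∨ e ∈ 𝒯.clE ∨ ∃ q ∈ e, q ∈ SQ)
  (hhubη : ∀ e ∈ 𝒯.hubE, e ∈ η)
  (hhubQ : ∀ (y : Site 2) (m : Fin 4), dartEdge y m ∈ 𝒯.hubE →
    segment ℝ (meshPoint δ y) (meshPoint δ (y + cornerUnit m)) ⊆ Q.carrier)
  (h0 : Disjoint (Q.side 0) (openEdgeUnion δ (η ∩ ↑𝒯.acc))) (h2 : Disjoint (Q.side 2) (openEdgeUnion δ (η ∩ ↑𝒯.acc)))
  (hacc : ∀ u v : Site 2, AccAdj η (↑𝒯.acc) u v → segment ℝ (meshPoint δ u) (meshPoint δ v) ⊆ Q.carrier)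
include h₀ hδ hcons hηSQ hX hhubη hhubQ h0 h2 hacc

omit hhubQ in
/-- **(⇒) Completeness of the side chain** (with squares). [cite: SchrammSmirnov2011, §4, proof of Prop. 4.1] -/
private theorem sideChain_of_mem_z2QuadConfig_sq (hQ : Q ∈ z2QuadConfig D δ η) :
    ∃ z₀ ∈ Q.side 0 ∩ openEdgeUnion δ η, ∃ z₂ ∈ Q.side 2,
      𝒯.RevPt Q δ η z₀ z₂ ∨ ∃ i j, 𝒯.StartAt d₀ Q δ η z₀ i ∧
        ReflTransGen (fun a b => 𝒯.Gst d₀ Q δ η a b ∨ 𝒯.Bit d₀ η a b) i j ∧ 𝒯.EndAt d₀ Q δ η j z₂ := by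
  have hJ := junction_mem_O_sq (𝒯 := 𝒯) hcons hηSQ hX
  obtain ⟨z₀, hz₀, z₂, hz₂, hchain⟩ := (mem_z2QuadConfig_iff_chain hδ Q hJ h0 h2 hacc).1 hQ
  refine ⟨z₀, hz₀, z₂, hz₂, ?_⟩
  -- abbreviations
  set R := fun a b => 𝒯.Gst d₀ Q δ η a b ∨ 𝒯.Bit d₀ η a b with hR
  -- the invariant
  let Inv : ℂ → Prop := fun p => 𝒯.RevPt Q δ η z₀ p ∨ ∃ i j, 𝒯.StartAt d₀ Q δ η z₀ i ∧ ReflTransGen R i j ∧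
    𝒯.hubContact d₀ j ∧ ∃ v ∈ 𝒯.att (𝒯.outCell d₀ j), 𝒯.RevPt Q δ η (meshPoint δ v) p
  -- the dock-chain invariant
  let J : Site 2 → Prop := fun c => ∃ i j, 𝒯.StartAt d₀ Q δ η z₀ i ∧ ReflTransGen R i j ∧ 𝒯.hubContact d₀ j ∧
    𝒯.outCell d₀ j = σc c ∧ c ∈ 𝒯.O ∧ meshPoint δ c ∈ openEdgeUnion δ (η \ ↑𝒯.acc) ∧ meshPoint δ c ∈ Q.carrier
  -- folding docking pieces
  have fold : ∀ c b, J c → ReflTransGen (fun x y => x ∈ 𝒯.O ∧ y ∈ 𝒯.O ∧ 𝒯.DockPiece η x y) c b → J b := by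
    intro c b hJc hcb
    induction hcb with
    | refl => exact hJc
    | @tail c' c'' _ hpiece ih =>
      obtain ⟨i, j, hstart, hrtg, hhubj, houtj, hc'O, hc'pt, hc'Q⟩ := ih
      obtain ⟨-, hc''O, k, k', hσ, hβ, hηc, hσ', hβ', hηc', hpath⟩ := hpiece
      obtain ⟨-, hc'W, -, -⟩ := dock_facts hacc hσ hβ hηc
      obtain ⟨-, hc''W, hc''Q, -⟩ := dock_facts hacc hσ' hβ' hηc'
      obtain ⟨ic, -, hcpt, houtic, hhubic, hattic⟩ := exists_side_of_dock h₀ hσ hβ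
      obtain ⟨j', -, hcpt', houtj', hhubj', hattj'⟩ := exists_side_of_dock h₀ hσ' hβ'
      have hbit : 𝒯.Bit d₀ η ic j' := ⟨c', k, c'', k', ⟨hσ, hβ, hηc, hcpt⟩, ⟨hσ', hβ', hηc', hcpt'⟩, hpath⟩
      have hgst : 𝒯.Gst d₀ Q δ η j ic := by
        refine ⟨hhubj, hhubic, c', ?_, c', hattic, RevPt.of_mem hc'pt hc'Q⟩
        rw [houtj]; exact mem_att_σc_iff.2 ⟨rfl, hc'O⟩
      exact ⟨i, j', hstart, (hrtg.tail (Or.inl hgst)).tail (Or.inr hbit), hhubj', houtj', hc''O,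
        meshPoint_mem_openEdgeUnion_of_hub (δ := δ) hhubη hc''O hc''W, hc''Q⟩
  -- the main induction along the chain
  have main : ∀ q, ReflTransGen (ChainStep Q δ η (↑𝒯.acc) 𝒯.O) z₀ q → Inv q := by
    intro q hq
    induction hq with
    | refl =>
      exact Or.inl (RevPt.of_mem (mem_openEdgeUnion_sdiff_of_side0 h0 hz₀.1 hz₀.2) (Q.side_subset_carrier 0 hz₀.1))
    | @tail p q _ hstep ih =>
      rcases hstep with ⟨S, hS, hSc, hp, hq⟩ | ⟨a, b, haO, hbO, rfl, rfl, hab⟩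
      · -- a revealed step
        have hpq : 𝒯.RevPt Q δ η p q := ⟨S, hS, hSc, hp, hq⟩
        rcases ih with h | ⟨i, j, hstart, hrtg, hhubj, v, hv, hrev⟩
        · exact Or.inl (h.trans hpq)
        · exact Or.inr ⟨i, j, hstart, hrtg, hhubj, v, hv, hrev.trans hpq⟩
      · -- a docking walk: split it into pieces
        have hd := exists_dockChain_of_accAdj haO hbO hab
        rcases hd.cases_head with rfl | ⟨c, hfirst, hrest⟩
        · exact ih
        · -- the first piece docks at `a`: establish `J a`
          obtain ⟨-, -, k, k', hσa, hβa, hηa, -⟩ := hfirst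
          obtain ⟨-, haW, haQ, -⟩ := dock_facts hacc hσa hβa hηa
          have hapt := meshPoint_mem_openEdgeUnion_of_hub (δ := δ) hhubη haO haW
          obtain ⟨ia, -, -, houtia, hhubia, hattia⟩ := exists_side_of_dock h₀ hσa hβa
          have hJa : J a := by
            rcases ih with h | ⟨i, j, hstart, hrtg, hhubj, v, hv, hrev⟩
            · exact ⟨ia, ia, ⟨hhubia, a, hattia, h⟩, ReflTransGen.refl, hhubia, houtia, haO, hapt, haQ⟩
            · have hgst : 𝒯.Gst d₀ Q δ η j ia := ⟨hhubj, hhubia, v, hv, a, hattia, hrev⟩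
              exact ⟨i, ia, hstart, hrtg.tail (Or.inl hgst), hhubia, houtia, haO, hapt, haQ⟩
          obtain ⟨i, j, hstart, hrtg, hhubj, houtj, -, hbpt, hbQ⟩ := fold a b hJa hd
          refine Or.inr ⟨i, j, hstart, hrtg, hhubj, b, ?_, RevPt.of_mem hbpt hbQ⟩
          rw [houtj]; exact mem_att_σc_iff.2 ⟨rfl, hbO⟩
  rcases main z₂ hchain with h | ⟨i, j, hstart, hrtg, hhubj, v, hv, hrev⟩
  · exact Or.inl h
  · exact Or.inr ⟨i, j, hstart, hrtg, ⟨hhubj, v, hv, hrev⟩⟩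

end SideChain

/-! ### The port chain with squares -/

section Ports

variable {D : Set ℂ} {δ : ℝ} {Q : Quad D} {η : BondConfig (Site 2)} {SQ : Set (Site 2)}

variable (h₀ : IsBd 𝒯.U d₀) (hT : 𝒯.Terminal)
  (hfar : ∀ c c' u₁ u₂ : Site 2, c ∈ 𝒯.O → c' ∈ 𝒯.O → (∃ f, TouchesFace c f ∧ TouchesFace c' f) →
    u₁ ∉ 𝒯.Wv → u₂ ∉ 𝒯.Wv → ReflTransGen (fun a b => s(a, b) ∈ 𝒯.hubE) c u₁ →
    ReflTransGen (fun a b => s(a, b) ∈ 𝒯.hubE) c' u₂ → ReflTransGen (FarAdj 𝒯) u₂ u₁)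
  (hhubη : ∀ e ∈ 𝒯.hubE, e ∈ η)
  (hhubQ : ∀ (y : Site 2) (m : Fin 4), dartEdge y m ∈ 𝒯.hubE →
    segment ℝ (meshPoint δ y) (meshPoint δ (y + cornerUnit m)) ⊆ Q.carrier)
include h₀ hT hfar hhubη hhubQ

variable (hδ : 0 < δ) (hcons : ∀ e ∈ 𝒯.clE, e ∉ η)
  (hηSQ : ∀ e ∈ (zdGraph 2).edgeSet, (∃ q ∈ e, q ∈ SQ) → e ∉ η)
  (hX : ∀ e ∈ (zdGraph 2).edgeSet, (∃ v ∈ e, v ∈ 𝒯.Wv) → (∃ u ∈ e, u ∉ 𝒯.Wv) →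
    e ∈ 𝒯.hubE ∨ e ∈ 𝒯.clE ∨ ∃ q ∈ e, q ∈ SQ)
  (hside0 : Disjoint (Q.side 0) (openEdgeUnion δ (η ∩ ↑𝒯.acc))) (hside2 : Disjoint (Q.side 2) (openEdgeUnion δ (η ∩ ↑𝒯.acc)))
  (hacc : ∀ u v : Site 2, AccAdj η (↑𝒯.acc) u v → segment ℝ (meshPoint δ u) (meshPoint δ v) ⊆ Q.carrier)
include hδ hcons hηSQ hX hside0 hside2 hacc

/-- **The crossing event of the cut quad as a function of the explored data and the port-level
bits**, with excised squares (stated with the chain on the left). [cite: SchrammSmirnov2011, §4, proof of Prop. 4.1 ("ω̃ ∈ ⊞_{Q₀} iff there is a path from ∂₀Q₀ to ∂₂Q₀ in G ∪ G*")] -/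
theorem portChain_iff_mem_z2QuadConfig_sq :
    (∃ z₀ ∈ Q.side 0 ∩ openEdgeUnion δ η, ∃ z₂ ∈ Q.side 2,
      𝒯.RevPt Q δ η z₀ z₂ ∨ ∃ i j, 𝒯.StartAt d₀ Q δ η z₀ i ∧
        ReflTransGen (fun a b => 𝒯.Gst d₀ Q δ η a b ∨ 𝒯.PortBit d₀ h₀ η a b) i j ∧ 𝒯.EndAt d₀ Q δ η j z₂) ↔
      Q ∈ z2QuadConfig D δ η := by
  symm
  rw [show Q ∈ z2QuadConfig D δ η ↔ ∃ z₀ ∈ Q.side 0 ∩ openEdgeUnion δ η, ∃ z₂ ∈ Q.side 2,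
      𝒯.RevPt Q δ η z₀ z₂ ∨ ∃ i j, 𝒯.StartAt d₀ Q δ η z₀ i ∧
        ReflTransGen (fun a b => 𝒯.Gst d₀ Q δ η a b ∨ 𝒯.Bit d₀ η a b) i j ∧ 𝒯.EndAt d₀ Q δ η j z₂ from
    ⟨sideChain_of_mem_z2QuadConfig_sq h₀ hδ hcons hηSQ hX hhubη hside0 hside2 hacc,
      fun ⟨_, hz₀, _, hz₂, h⟩ => mem_z2QuadConfig_of_sideChain h₀ hδ hhubη hhubQ hacc hz₀.1 hz₀.2 hz₂ h⟩]
  -- the two chain relations generate the same connectivity between hub contacts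
  have bitHub : ∀ {a b}, 𝒯.Bit d₀ η a b → 𝒯.hubContact d₀ a ∧ 𝒯.hubContact d₀ b := by
    rintro a b ⟨x, k, x', k', ⟨hσ, hβ, -, hcpt⟩, ⟨hσ', hβ', -, hcpt'⟩, -⟩
    exact ⟨(𝒯.hubContact_of_docking h₀ (mem_O_of_dock hσ hβ) hβ hcpt).2.1,
      (𝒯.hubContact_of_docking h₀ (mem_O_of_dock hσ' hβ') hβ' hcpt').2.1⟩
  have fwd : ∀ {a b}, (𝒯.Gst d₀ Q δ η a b ∨ 𝒯.Bit d₀ η a b) →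
      ReflTransGen (fun a b => 𝒯.Gst d₀ Q δ η a b ∨ 𝒯.PortBit d₀ h₀ η a b) a b := by
    rintro a b (h | h)
    · exact ReflTransGen.single (Or.inl h)
    · obtain ⟨ha, hb⟩ := bitHub h
      by_cases hsame : 𝒯.SamePort d₀ h₀ a b
      · exact ReflTransGen.single (Or.inl (gst_of_samePort h₀ hT hfar hhubη hhubQ ha hb hsame))
      · exact ReflTransGen.single (Or.inr ⟨ha, hb, hsame, a, b, samePort_refl h₀ ha, samePort_refl h₀ hb, h⟩ :
          𝒯.Gst d₀ Q δ η a b ∨ 𝒯.PortBit d₀ h₀ η a b)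
  have bwd : ∀ {a b}, (𝒯.Gst d₀ Q δ η a b ∨ 𝒯.PortBit d₀ h₀ η a b) →
      ReflTransGen (fun a b => 𝒯.Gst d₀ Q δ η a b ∨ 𝒯.Bit d₀ η a b) a b := by
    rintro a b (h | ⟨ha, hb, -, a', b', haa', hbb', hbit⟩)
    · exact ReflTransGen.single (Or.inl h)
    · obtain ⟨ha', hb'⟩ := bitHub hbit
      have s1 : ReflTransGen (fun a b => 𝒯.Gst d₀ Q δ η a b ∨ 𝒯.Bit d₀ η a b) a a' :=
        ReflTransGen.single (Or.inl (gst_of_samePort h₀ hT hfar hhubη hhubQ ha ha' haa'))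
      have s2 : ReflTransGen (fun a b => 𝒯.Gst d₀ Q δ η a b ∨ 𝒯.Bit d₀ η a b) a b' := s1.tail (Or.inr hbit)
      exact s2.tail (Or.inl (gst_of_samePort h₀ hT hfar hhubη hhubQ hb' hb hbb'.symm))
  have lift : ∀ {r r' : ℕ → ℕ → Prop}, (∀ {a b}, r a b → ReflTransGen r' a b) → ∀ {a b}, ReflTransGen r a b → ReflTransGen r' a b := by
    intro r r' h a b hab
    induction hab with
    | refl => exact ReflTransGen.refl
    | tail _ hs ih => exact ih.trans (h hs)
  constructor
  · rintro ⟨z₀, hz₀, z₂, hz₂, h⟩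
    refine ⟨z₀, hz₀, z₂, hz₂, h.imp id ?_⟩
    rintro ⟨i, j, hs, hc, he⟩
    exact ⟨i, j, hs, lift fwd hc, he⟩
  · rintro ⟨z₀, hz₀, z₂, hz₂, h⟩
    refine ⟨z₀, hz₀, z₂, hz₂, h.imp id ?_⟩
    rintro ⟨i, j, hs, hc, he⟩
    exact ⟨i, j, hs, lift bwd hc, he⟩

end Ports

end TileData

end CellComplex

end Literature.Probability.Percolation

end
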